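import Literature.NumberTheory.PAdicHodge.BdRLegendreDivisibility
import Literature.NumberTheory.PAdicHodge.BdRPeriodDeterminantTransversal
import HarnessLib

/-!
# The basis-free `Fil⁰`-coboundary criterion: a `T_p`-valued map with two INTEGRATED periods dies in `H¹(F, B_dR⁺ ⊗ V_p)`

Topic `Literature/NumberTheory/PAdicHodge`; namespace `Literature.NumberTheory.PAdicHodge`. THEOREMS ONLY (no definition, no named
fact, no instance, no `sorry`). Assembly of `BdRLegendreDivisibility` (`Δ ∈ Fil¹ ∖ Fil²` divides `Fil¹` into `B_dR⁺`;
`IsFilZeroCoboundary` from `Δ ∉ Fil²`) and `BdRPeriodDeterminantTransversal` (`Δ ∉ Fil²` from TATE's theorem):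

* **`isFilZeroCoboundary_rationalTateModule_of_periodHoms`** / **`isFilZeroCoboundary_restrictedRationalTateRep_of_periodHoms`** — two
  additive `ℤ_p`-homogeneous `Γ_F`-equivariant period maps `φ₁ ⊆ Fil¹` (with a value outside `Fil²`: the Hodge–Tate map `≢ 0`) and
  `φ₂ ⊆ B_dR⁺` (with a value outside `Fil¹`) on `T_p` (`dim V_p = 2`), and a map `η : Γ_F → T_p` with `φ₁(η σ) = σ b₁ − b₁`,
  `b₁ ∈ Fil¹`, `φ₂(η σ) = σ b₂ − b₂`, `b₂ ∈ B_dR⁺` ⟹ `σ ↦ 1 ⊗ η(σ)` is a `Fil⁰`-coboundary of `B_dR ⊗ V_p` (`IsFilZeroCoboundary`) —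
  the «⟸» mechanism of the cite-only (S5a) `expStarCoord_eq_zero_iff_kummer` for every map whose two periods are INTEGRATED, with NO
  basis and NO Legendre hypothesis left.

Use: brick K1 of the hT₂ programme of crux K★ `stmt-BirchSwinnertonDyer-22226` (capstone `KummerFilZeroCoboundarySupersingular`).
BSD / K★ are not proved by any of this.

## References
* [BlochKato1990] S. Bloch, K. Kato (1990), Ex. 3.10.1, (3.11.1), Lemma 3.8.1.
* [Tate1967] J. Tate, *p-divisible groups* (1967), §3.3 Thm. 2, §4.
* [Kato1993LNM1553] K. Kato, LNM 1553 (1993), Ch. II Lemma 1.4.3.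
-/

noncomputable section

open scoped TensorProduct

namespace Literature.NumberTheory.PAdicHodge

open Literature Literature.NumberTheory.GaloisRepresentations Literature.NumberTheory.EllipticCurves WeierstrassCurve
open Literature.NumberTheory.GaloisRepresentations.IsNonarchimedeanLocalField Field ValuativeRel WittVector

variable {F : Type} [Field F] [ValuativeRel F] [TopologicalSpace F] [IsNonarchimedeanLocalField F] [CharZero F]
  {p : ℕ} [Fact p.Prime] [Fact (¬ IsUnit (p : integerC F))] [IsAdicComplete (Ideal.span {(p : integerC F)}) (integerC F)]
  (hp : valuation F p < 1) [Algebra ℚ_[p] F]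

/-! ## The basis-free criterion: Legendre discharged by Tate's theorem -/

section Generic

variable {A : Type} [AddCommGroup A] (ρ : GaloisRep F ℚ_[p] (RationalTateModule A p))
  (act : absoluteGaloisGroup F → TateModule A p → TateModule A p)

/-- **`Fil⁰`-coboundary in `B_dR ⊗ V_pA` from two integrated periods** (no basis, no Legendre hypothesis): `ρ` on the
`2`-dimensional `V_pA` induced by `act`; `φ₁ φ₂ : T_pA →+ B_dR(F)` additive, `ℤ_p`-homogeneous, equivariant, `φ₁ ⊆ Fil¹` with
`φ₁(a₁) ∉ Fil²` for some `a₁`, `φ₂ ⊆ Fil⁰` with `φ₂(a₂) ∉ Fil¹` for some `a₂`; `η : Γ_F → T_pA` with `φ₁(η σ) = σ b₁ − b₁`, `b₁ ∈ Fil¹`,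
`φ₂(η σ) = σ b₂ − b₂`, `b₂ ∈ Fil⁰`. Then `σ ↦ 1 ⊗ η(σ)` is a `Fil⁰`-coboundary (`IsFilZeroCoboundary`).
[cite: BlochKato1990, Ex. 3.10.1, (3.11.1), Lemma 3.8.1] [cite: Tate1967, §3.3 Theorem 2 and §4] -/
theorem isFilZeroCoboundary_rationalTateModule_of_periodHoms [Module.Finite ℚ_[p] (RationalTateModule A p)]
    (h2 : Module.finrank ℚ_[p] (RationalTateModule A p) = 2)
    (hρ : ∀ (σ : absoluteGaloisGroup F) (c : ℚ_[p]) (a : TateModule A p),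
      ρ σ ((c ⊗ₜ[ℤ_[p]] a : ℚ_[p] ⊗[ℤ_[p]] TateModule A p) : RationalTateModule A p) =
        ((c ⊗ₜ[ℤ_[p]] act σ a : ℚ_[p] ⊗[ℤ_[p]] TateModule A p) : RationalTateModule A p))
    (φ₁ φ₂ : TateModule A p →+ (bdRPeriodRingData (F := F) (p := p) hp).B)
    (hφ₁ : ∀ (c : ℤ_[p]) (a : TateModule A p), φ₁ (c • a) = (c : ℚ_[p]) • φ₁ a)
    (hφ₂ : ∀ (c : ℤ_[p]) (a : TateModule A p), φ₂ (c • a) = (c : ℚ_[p]) • φ₂ a)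
    (hσ₁ : ∀ (σ : absoluteGaloisGroup F) (a : TateModule A p), φ₁ (act σ a) = σ • φ₁ a)
    (hσ₂ : ∀ (σ : absoluteGaloisGroup F) (a : TateModule A p), φ₂ (act σ a) = σ • φ₂ a)
    (hfil₁ : ∀ a, φ₁ a ∈ (bdRPeriodRingData (F := F) (p := p) hp).fil 1)
    (hfil₂ : ∀ a, φ₂ a ∈ (bdRPeriodRingData (F := F) (p := p) hp).fil 0)
    (hne : ∃ a, φ₁ a ∉ (bdRPeriodRingData (F := F) (p := p) hp).fil 2)
    (hnot : ∃ a, φ₂ a ∉ (bdRPeriodRingData (F := F) (p := p) hp).fil 1)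
    (η : absoluteGaloisGroup F → TateModule A p) {b₁ b₂ : (bdRPeriodRingData (F := F) (p := p) hp).B}
    (hb₁ : b₁ ∈ (bdRPeriodRingData (F := F) (p := p) hp).fil 1) (hb₂ : b₂ ∈ (bdRPeriodRingData (F := F) (p := p) hp).fil 0)
    (hη₁ : ∀ σ, φ₁ (η σ) = σ • b₁ - b₁) (hη₂ : ∀ σ, φ₂ (η σ) = σ • b₂ - b₂) :
    (bdRPeriodRingData (F := F) (p := p) hp).IsFilZeroCoboundary ρ fun σ =>
      ((1 : (bdRPeriodRingData (F := F) (p := p) hp).B) ⊗ₜ[ℚ_[p]] TateModule.toRational p (η σ) :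
        (bdRPeriodRingData (F := F) (p := p) hp).B ⊗[ℚ_[p]] RationalTateModule A p) := by
  classical
  let v : Module.Basis (Fin 2) ℚ_[p] (RationalTateModule A p) := Module.finBasisOfFinrankEq ℚ_[p] _ h2
  have hne' : ∃ a, φ₁ a ≠ 0 := by
    obtain ⟨a, ha⟩ := hne
    exact ⟨a, fun h0 => ha (by rw [h0]; exact zero_mem _)⟩
  refine isFilZeroCoboundary_rationalTateModule_of_periodHoms_of_legendre (bdRPeriodRingData (F := F) (p := p) hp) ρ act hρ v
    φ₁ φ₂ hφ₁ hφ₂ hσ₁ hσ₂ hfil₁ hfil₂ hne' hnot (fun Φ₁ Φ₂ hΦ₁ hΦ₂ => ?_) η hb₁ hb₂ hη₁ hη₂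
  obtain ⟨Φ₁', hΦ₁', hΦ₁σ⟩ := exists_equivariant_extend_rationalTateModule (bdRPeriodRingData (F := F) (p := p) hp) ρ act hρ φ₁ hφ₁ hσ₁
  obtain ⟨Φ₂', hΦ₂', hΦ₂σ⟩ := exists_equivariant_extend_rationalTateModule (bdRPeriodRingData (F := F) (p := p) hp) ρ act hρ φ₂ hφ₂ hσ₂
  -- the extensions are unique (`V_p` is spanned by `T_p`), so `Φᵢ = Φᵢ'` are equivariant
  have huniq : ∀ (Ψ Ψ' : RationalTateModule A p →ₗ[ℚ_[p]] (bdRPeriodRingData (F := F) (p := p) hp).B),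
      (∀ a, Ψ (TateModule.toRational p a) = Ψ' (TateModule.toRational p a)) → Ψ = Ψ' := fun Ψ Ψ' h => by
    have hsub : ∀ x, (Ψ - Ψ') x ∈ (⊥ : Submodule F (bdRPeriodRingData (F := F) (p := p) hp).B) :=
      apply_mem_of_forall_toRational_mem _ (Ψ - Ψ') ⊥ fun a => by
        rw [LinearMap.sub_apply, h a, sub_self]; exact zero_mem _
    ext x
    exact sub_eq_zero.1 ((Submodule.mem_bot F).1 (hsub x))
  have e₁ : Φ₁ = Φ₁' := huniq _ _ fun a => by rw [hΦ₁, hΦ₁']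
  have e₂ : Φ₂ = Φ₂' := huniq _ _ fun a => by rw [hΦ₂, hΦ₂']
  subst e₁ e₂
  obtain ⟨a₁, ha₁⟩ := hne
  obtain ⟨a₂, ha₂⟩ := hnot
  have hΔ1 : Φ₁ (v 0) * Φ₂ (v 1) - Φ₁ (v 1) * Φ₂ (v 0) ∈ (bdRPeriodRingData (F := F) (p := p) hp).fil 1 := by
    have hΦ₁fil : ∀ x, Φ₁ x ∈ (bdRPeriodRingData (F := F) (p := p) hp).fil 1 :=
      apply_mem_of_forall_toRational_mem _ Φ₁ _ fun a => by rw [hΦ₁]; exact hfil₁ a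
    have hΦ₂fil : ∀ x, Φ₂ x ∈ (bdRPeriodRingData (F := F) (p := p) hp).fil 0 :=
      apply_mem_of_forall_toRational_mem _ Φ₂ _ fun a => by rw [hΦ₂]; exact hfil₂ a
    refine sub_mem ?_ ?_
    · simpa using (bdRPeriodRingData (F := F) (p := p) hp).mul_mem_fil 1 0 _ _ (hΦ₁fil (v 0)) (hΦ₂fil (v 1))
    · simpa using (bdRPeriodRingData (F := F) (p := p) hp).mul_mem_fil 1 0 _ _ (hΦ₁fil (v 1)) (hΦ₂fil (v 0))
  refine exists_mem_fil_zero_eq_mul_of_not_mem_fil_two hp hΔ1 ?_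
  exact det_not_mem_fil_two_of_periodHoms hp ρ v Φ₁ Φ₂ hΦ₁σ hΦ₂σ
    (apply_mem_of_forall_toRational_mem _ Φ₁ _ fun a => by rw [hΦ₁]; exact hfil₁ a)
    (apply_mem_of_forall_toRational_mem _ Φ₂ _ fun a => by rw [hΦ₂]; exact hfil₂ a)
    ⟨TateModule.toRational p a₁, by rwa [hΦ₁]⟩ ⟨TateModule.toRational p a₂, by rwa [hΦ₂]⟩

end Generic

/-- **(S5a)-⟸ mechanism for `V_pW|_{Γ_F}`, basis-free**: `W` over a subfield `K₀ ⊆ F`; two additive `ℤ_p`-homogeneous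
`Γ_F`-equivariant period maps `φ₁ φ₂ : T_pW → B_dR(F)` with `φ₁ ⊆ Fil¹`, `φ₁(τ₁) ∉ Fil²` (Hodge–Tate map nonzero), `φ₂ ⊆ B_dR⁺`,
`φ₂(τ₂) ∉ Fil¹`; any `η : Γ_F → T_pW` whose two periods are integrated (`φ₁(η σ) = σ b₁ − b₁`, `b₁ ∈ Fil¹`; `φ₂(η σ) = σ b₂ − b₂`,
`b₂ ∈ B_dR⁺`). Then `(bdRPeriodRingData hp).IsFilZeroCoboundary (restrictedRationalTateRep W F p) (σ ↦ 1 ⊗ toRational (η σ))`.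
[cite: BlochKato1990, Ex. 3.10.1, (3.11.1), Lemma 3.8.1] [cite: Kato1993LNM1553, Ch. II Lemma 1.4.3] [cite: Tate1967, §3.3 Theorem 2] -/
theorem isFilZeroCoboundary_restrictedRationalTateRep_of_periodHoms {K₀ : Type} [Field K₀] [CharZero K₀]
    (W : WeierstrassCurve K₀) [W.IsElliptic] [Algebra K₀ F]
    (φ₁ φ₂ : W.tateModule p →+ (bdRPeriodRingData (F := F) (p := p) hp).B)
    (hφ₁ : ∀ (c : ℤ_[p]) (a : W.tateModule p), φ₁ (c • a) = (c : ℚ_[p]) • φ₁ a)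
    (hφ₂ : ∀ (c : ℤ_[p]) (a : W.tateModule p), φ₂ (c • a) = (c : ℚ_[p]) • φ₂ a)
    (hσ₁ : ∀ (σ : absoluteGaloisGroup F) (a : W.tateModule p), φ₁ (absGaloisRestrict K₀ F σ • a) = σ • φ₁ a)
    (hσ₂ : ∀ (σ : absoluteGaloisGroup F) (a : W.tateModule p), φ₂ (absGaloisRestrict K₀ F σ • a) = σ • φ₂ a)
    (hfil₁ : ∀ a, φ₁ a ∈ (bdRPeriodRingData (F := F) (p := p) hp).fil 1)
    (hfil₂ : ∀ a, φ₂ a ∈ (bdRPeriodRingData (F := F) (p := p) hp).fil 0)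
    (hne : ∃ a, φ₁ a ∉ (bdRPeriodRingData (F := F) (p := p) hp).fil 2)
    (hnot : ∃ a, φ₂ a ∉ (bdRPeriodRingData (F := F) (p := p) hp).fil 1)
    (η : absoluteGaloisGroup F → W.tateModule p) {b₁ b₂ : (bdRPeriodRingData (F := F) (p := p) hp).B}
    (hb₁ : b₁ ∈ (bdRPeriodRingData (F := F) (p := p) hp).fil 1) (hb₂ : b₂ ∈ (bdRPeriodRingData (F := F) (p := p) hp).fil 0)
    (hη₁ : ∀ σ, φ₁ (η σ) = σ • b₁ - b₁) (hη₂ : ∀ σ, φ₂ (η σ) = σ • b₂ - b₂) :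
    (bdRPeriodRingData (F := F) (p := p) hp).IsFilZeroCoboundary (restrictedRationalTateRep W F p) fun σ =>
      ((1 : (bdRPeriodRingData (F := F) (p := p) hp).B) ⊗ₜ[ℚ_[p]] TateModule.toRational p (η σ) :
        (bdRPeriodRingData (F := F) (p := p) hp).B ⊗[ℚ_[p]] W.rationalTateModule p) := by
  have hpK : (p : K₀) ≠ 0 := Nat.cast_ne_zero.mpr (Fact.out : p.Prime).ne_zero
  haveI : Module.Finite ℚ_[p] (W.rationalTateModule p) := module_finite_rationalTateModule_holds W p
  exact isFilZeroCoboundary_rationalTateModule_of_periodHoms hp (restrictedRationalTateRep W F p)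
    (fun σ a => absGaloisRestrict K₀ F σ • a) (finrank_rationalTateModule_eq_two_holds W p hpK) (fun _ _ _ => rfl)
    φ₁ φ₂ hφ₁ hφ₂ hσ₁ hσ₂ hfil₁ hfil₂ hne hnot η hb₁ hb₂ hη₁ hη₂

end Literature.NumberTheory.PAdicHodge

end
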